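import Mathlib
import Summits.CriticalPhenomena.PercolationContinuityZ3.Theorems.PercNearOneGluingNoHeavyLowerTailIntervalCertificates

/-!
# The interval game: point-and-Möbius certificates for (MS2) with reserved terms (hp-7 gen 77)

Support file for crux `stmt-CriticalPhenomena-4575` (route `PercNearOneGluingNoHeavy`), hull-port seat `prim-hp-7`
(generation 77); `--supports stmt-CriticalPhenomena-4575`.  No `sorry`.  Memo:
`run/shared/lean/prim/prim-hp-7/FROM-prim-hp-7-g77-INTERVAL-GAME.md`.

The second-order Marica–Schönheim conjecture (`GeneratedDonors.MS2`, file `…HexMSMatchMS2`) asks, for a two-coloured family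
`F = P ⊔ Q` with designated cross differences `D₅ ⊆ P \\ Q`, `D₂ ⊆ Q \\ P`, that
`#(F ∪ D₅ ∪ D₂) ≤ #T`, `T = F \\ F ∪ P \\ D₅ ∪ Q \\ D₂`.  Gen 76 reduced it (for dead = pairwise intersecting families) to the
existence of an ORDER certificate (`ReservedTerms.ms2_of_orderCert`: Möbius functionals based at `∅` with complement columns)
or of a LINEAR certificate (`ReservedTerms.ms2_of_incCert`); order certificates with natural reserved terms fail on the
'butterflies' (0.04 % of intersecting instances), linear ones never failed (2.7·10⁶ instances).  Gen 77 closes the gap between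
the two with a certificate that is still purely combinatorial:

* `IntervalGame.card_add_card_le_card_of_intCert` — **the interval game.**  Members `f ∈ F` are peeled along a rank function;
  the member `f` is isolated from every later member `g` by a based Möbius functional with base `L f ⊆ f` (a term outside the
  reserved set `Θ`) and probe `V f` disjoint from `f`: whenever a later `g` contains `L f`, the probe meets `g` and
  `L f ∪ (V f ∩ g)` is an unreserved term.  Then `#F + #Θ ≤ #T`.  (`IntervalCertificate.card_le_card_of_certificate` with rows
  `[L f, L f ∪ V f]` and the members themselves as columns.)  `L f = ∅`, `V f = S \ f` is the ordered Marica–Schönheim rule of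
  `ReservedTerms`; `V f = ∅` is POINT EVALUATION at a private term `L f` (no later member contains it).
* `IntervalGame.ms2_of_intCert` — the (MS2) inequality for an instance from such a certificate with `Θ = τ(D₅ ∪ D₂)`.
* `IntervalGame.ms2_of_psCert` — the **point-or-standard** special form: every member is peeled either by a private unreserved
  term `E f ⊆ f` contained in no later member, or (standard) because every later member `g` has a nonempty unreserved trace
  `g \ f`.  NUMERICAL FACT (gen 77, memo §1): point-or-standard certificates with NATURAL reserved terms
  (`τ d ∈ {d} ∪ {m \ d : m in d's block}`) exist for every intersecting instance tested (`n ≤ 7`, incl. all butterflies),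
  so the natural-menu conjecture survives in this combinatorial form (conjecture `PS-nat`, between gen 76's `C1-nat` (false on
  butterflies) and `INC-nat`).
-/

namespace Summit.CriticalPhenomena.PercolationContinuityZ3.Theorems

namespace IntervalGame

open Finset
open scoped FinsetFamily

variable {α : Type*} [DecidableEq α]

/-- **The interval game** (hp-7 gen 77).  Let `Θ ⊆ T` be families of sets ('reserved' ⊆ 'terms'), `r` a rank function on a
family `F`, and for each member `f` a base `L f ⊆ f` that is an unreserved term and a probe `V f` disjoint from `f`, such that
for `f ≠ g` in `F` with `r f ≤ r g` and `L f ⊆ g` the probe meets `g` and `L f ∪ (V f ∩ g)` is an unreserved term.  Then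
`#F + #Θ ≤ #T`. -/
theorem card_add_card_le_card_of_intCert {β : Type*} [LinearOrder β] (F T Θ : Finset (Finset α))
    (r : Finset α → β) (L V : Finset α → Finset α) (hΘT : Θ ⊆ T)
    (hL : ∀ f ∈ F, L f ⊆ f ∧ L f ∈ T ∧ L f ∉ Θ)
    (hV : ∀ f ∈ F, Disjoint (V f) f)
    (hsep : ∀ f ∈ F, ∀ g ∈ F, f ≠ g → r f ≤ r g → L f ⊆ g →
      (V f ∩ g).Nonempty ∧ L f ∪ (V f ∩ g) ∈ T ∧ L f ∪ (V f ∩ g) ∉ Θ) :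
    #F + #Θ ≤ #T := by
  classical
  set K : Finset (Finset α) := T \ Θ with hK
  have hKcard : #K + #Θ = #T := card_sdiff_add_card_eq_card hΘT
  suffices hF : #F ≤ #K by omega
  have hmain := IntervalCertificate.card_le_card_of_certificate (ι := ↥F) K (fun f => r (f : Finset α))
    (fun f => L (f : Finset α)) (fun f => L (f : Finset α) ∪ V (f : Finset α)) (fun f => (f : Finset α)) ?_ ?_ ?_
  · rwa [Fintype.card_coe] at hmain
  · rintro ⟨f, hf⟩
    obtain ⟨hLf, -, -⟩ := hL f hf
    show L f = (L f ∪ V f) ∩ f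
    rw [union_inter_distrib_right, inter_eq_left.mpr hLf, disjoint_iff_inter_eq_empty.mp (hV f hf), union_empty]
  · rintro ⟨f, hf⟩
    obtain ⟨-, hT, hΘ⟩ := hL f hf
    exact mem_sdiff.mpr ⟨hT, hΘ⟩
  · rintro ⟨f, hf⟩ ⟨g, hg⟩ hne hr
    have hne' : f ≠ g := fun h => hne (Subtype.ext h)
    by_cases hLg : L f ⊆ g
    · right
      obtain ⟨hne0, hT, hΘ⟩ := hsep f hf g hg hne' hr hLg
      have heq : (L f ∪ V f) ∩ g = L f ∪ (V f ∩ g) := by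
        rw [union_inter_distrib_right, inter_eq_left.mpr hLg]
      show (L f ∪ V f) ∩ g ∈ K ∧ (L f ∪ V f) ∩ g ≠ L f
      rw [heq]
      refine ⟨mem_sdiff.mpr ⟨hT, hΘ⟩, ?_⟩
      intro h
      obtain ⟨x, hx⟩ := hne0
      have hxL : x ∈ L f := by
        rw [← h]
        exact mem_union_right _ hx
      obtain ⟨hLf, -, -⟩ := hL f hf
      exact (disjoint_left.mp (hV f hf)) (mem_inter.mp hx).1 (hLf hxL)
    · left
      exact hLg

/-- **(MS2) from an interval-game certificate** (hp-7 gen 77).  For an instance `(P, Q, D₅, D₂)` with term set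
`T = F \\ F ∪ P \\ D₅ ∪ Q \\ D₂` (`F = P ∪ Q`): an injection `τ` of the designated sets into `T`, a rank function and bases /
probes as in `card_add_card_le_card_of_intCert` whose terms avoid the values of `τ` give `#(F ∪ D₅ ∪ D₂) ≤ #T`. -/
theorem ms2_of_intCert {β : Type*} [LinearOrder β] (P Q D₅ D₂ : Finset (Finset α))
    (r : Finset α → β) (τ L V : Finset α → Finset α)
    (hτT : ∀ d ∈ D₅ ∪ D₂, τ d ∈ ((P ∪ Q) \\ (P ∪ Q)) ∪ (P \\ D₅) ∪ (Q \\ D₂))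
    (hτinj : Set.InjOn τ ↑(D₅ ∪ D₂))
    (hL : ∀ f ∈ P ∪ Q, L f ⊆ f ∧ L f ∈ ((P ∪ Q) \\ (P ∪ Q)) ∪ (P \\ D₅) ∪ (Q \\ D₂) ∧ ∀ d ∈ D₅ ∪ D₂, τ d ≠ L f)
    (hV : ∀ f ∈ P ∪ Q, Disjoint (V f) f)
    (hsep : ∀ f ∈ P ∪ Q, ∀ g ∈ P ∪ Q, f ≠ g → r f ≤ r g → L f ⊆ g →
      (V f ∩ g).Nonempty ∧ L f ∪ (V f ∩ g) ∈ ((P ∪ Q) \\ (P ∪ Q)) ∪ (P \\ D₅) ∪ (Q \\ D₂) ∧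
        ∀ d ∈ D₅ ∪ D₂, τ d ≠ L f ∪ (V f ∩ g)) :
    #((P ∪ Q) ∪ D₅ ∪ D₂) ≤ #(((P ∪ Q) \\ (P ∪ Q)) ∪ (P \\ D₅) ∪ (Q \\ D₂)) := by
  classical
  set F := P ∪ Q with hFdef
  set D := D₅ ∪ D₂ with hDdef
  set T := (F \\ F) ∪ (P \\ D₅) ∪ (Q \\ D₂) with hTdef
  have h1 : (P ∪ Q) ∪ D₅ ∪ D₂ = F ∪ D := by rw [hDdef, union_assoc]
  rw [h1]
  set Θ := D.image τ with hΘdef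
  have hΘcard : #Θ = #D := card_image_of_injOn hτinj
  have hΘT : Θ ⊆ T := by
    intro t ht
    obtain ⟨d, hd, rfl⟩ := mem_image.mp ht
    exact hτT d hd
  have hnot : ∀ {t : Finset α}, (∀ d ∈ D, τ d ≠ t) → t ∉ Θ := by
    intro t ht h
    obtain ⟨d, hd, hdt⟩ := mem_image.mp h
    exact ht d hd hdt
  have hres := card_add_card_le_card_of_intCert F T Θ r L V hΘT
    (fun f hf => ⟨(hL f hf).1, (hL f hf).2.1, hnot (hL f hf).2.2⟩) hV
    (fun f hf g hg hne hr hLg =>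
      ⟨(hsep f hf g hg hne hr hLg).1, (hsep f hf g hg hne hr hLg).2.1, hnot (hsep f hf g hg hne hr hLg).2.2⟩)
  calc #(F ∪ D) ≤ #F + #D := card_union_le F D
    _ = #F + #Θ := by rw [hΘcard]
    _ ≤ #T := hres

/-- **(MS2) from a point-or-standard certificate** (hp-7 gen 77).  Along a rank function on `F = P ∪ Q`, every member `f` is
either a POINT member (`f ∈ Pt`): its private term `E f ⊆ f` is an unreserved term contained in no other member of rank `≥ r f`;
or a STANDARD member: every other member `g` of rank `≥ r f` has a nonempty unreserved trace `g \ f` (and `∅` is unreserved).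
With an injection `τ` of the designated sets into `T = F \\ F ∪ P \\ D₅ ∪ Q \\ D₂` ('reserved terms') this gives
`#(F ∪ D₅ ∪ D₂) ≤ #T`.  Conjecture `PS-nat` (memo §1): such certificates with `τ d ∈ {d} ∪ {m \ d}` always exist for pairwise
intersecting `F` and pure `D₅, D₂`. -/
theorem ms2_of_psCert {β : Type*} [LinearOrder β] (P Q D₅ D₂ Pt : Finset (Finset α))
    (r : Finset α → β) (τ E : Finset α → Finset α)
    (hτT : ∀ d ∈ D₅ ∪ D₂, τ d ∈ ((P ∪ Q) \\ (P ∪ Q)) ∪ (P \\ D₅) ∪ (Q \\ D₂))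
    (hτinj : Set.InjOn τ ↑(D₅ ∪ D₂)) (hτ0 : ∀ d ∈ D₅ ∪ D₂, τ d ≠ ∅)
    (hpt : ∀ f ∈ P ∪ Q, f ∈ Pt → E f ⊆ f ∧ E f ∈ ((P ∪ Q) \\ (P ∪ Q)) ∪ (P \\ D₅) ∪ (Q \\ D₂) ∧
      (∀ d ∈ D₅ ∪ D₂, τ d ≠ E f) ∧ ∀ g ∈ P ∪ Q, f ≠ g → r f ≤ r g → ¬ E f ⊆ g)
    (hstd : ∀ f ∈ P ∪ Q, f ∉ Pt → ∀ g ∈ P ∪ Q, f ≠ g → r f ≤ r g →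
      (g \ f).Nonempty ∧ ∀ d ∈ D₅ ∪ D₂, τ d ≠ g \ f) :
    #((P ∪ Q) ∪ D₅ ∪ D₂) ≤ #(((P ∪ Q) \\ (P ∪ Q)) ∪ (P \\ D₅) ∪ (Q \\ D₂)) := by
  classical
  set F := P ∪ Q with hFdef
  rcases F.eq_empty_or_nonempty with hF0 | ⟨f₀, hf₀⟩
  · -- no members: no cross differences either
    have hP : P = ∅ := subset_empty.mp (hF0 ▸ (subset_union_left : P ⊆ F))
    have hQ : Q = ∅ := subset_empty.mp (hF0 ▸ (subset_union_right : Q ⊆ F))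
    have hD : D₅ ∪ D₂ = ∅ := by
      rw [eq_empty_iff_forall_notMem]
      intro d hd
      have ht := hτT d hd
      rw [hP, hQ, hF0] at ht
      simp at ht
    have : (P ∪ Q) ∪ D₅ ∪ D₂ = F ∪ (D₅ ∪ D₂) := by rw [union_assoc]
    rw [this, hD, hF0]
    simp
  let S : Finset α := F.sup id
  have hS : ∀ {f : Finset α}, f ∈ F → f ⊆ S := fun hf => le_sup (f := id) hf
  have h0T : (∅ : Finset α) ∈ (F \\ F) ∪ (P \\ D₅) ∪ (Q \\ D₂) :=
    mem_union_left _ (mem_union_left _ (mem_diffs.mpr ⟨f₀, hf₀, f₀, hf₀, (by simp : f₀ \ f₀ = ∅)⟩))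
  refine ms2_of_intCert P Q D₅ D₂ r τ (fun f => if f ∈ Pt then E f else ∅)
    (fun f => if f ∈ Pt then ∅ else S \ f) hτT hτinj ?_ ?_ ?_
  · intro f hf
    by_cases hfp : f ∈ Pt
    · simp only [if_pos hfp]
      obtain ⟨h1, h2, h3, -⟩ := hpt f hf hfp
      exact ⟨h1, h2, h3⟩
    · simp only [if_neg hfp]
      exact ⟨empty_subset f, h0T, fun d hd => hτ0 d hd⟩
  · intro f hf
    by_cases hfp : f ∈ Pt
    · simp only [if_pos hfp]
      exact disjoint_bot_left
    · simp only [if_neg hfp]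
      exact disjoint_left.mpr fun x hx hxf => (mem_sdiff.mp hx).2 hxf
  · intro f hf g hg hne hr hLg
    by_cases hfp : f ∈ Pt
    · simp only [if_pos hfp] at hLg ⊢
      exact absurd hLg ((hpt f hf hfp).2.2.2 g hg hne hr)
    · simp only [if_neg hfp] at hLg ⊢
      obtain ⟨hne0, hτ⟩ := hstd f hf hfp g hg hne hr
      have heq : (S \ f) ∩ g = g \ f := by
        ext x
        simp only [mem_inter, mem_sdiff]
        constructor
        · rintro ⟨⟨-, hxf⟩, hxg⟩
          exact ⟨hxg, hxf⟩
        · rintro ⟨hxg, hxf⟩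
          exact ⟨⟨hS hg hxg, hxf⟩, hxg⟩
      rw [heq, empty_union]
      exact ⟨hne0, mem_union_left _ (mem_union_left _ (mem_diffs.mpr ⟨g, hg, f, hf, rfl⟩)), hτ⟩


/-! ### Appended (hp-7 gen 78): the counting form of point-or-standard certificates

As for order certificates (`Reduction.ms2_of_card_le_card_nonForward`), the reserved terms of a point-or-standard certificate need no menu: any
injection of the designated sets into the nonempty terms that are neither a point term `E f` nor a forward trace `g \ f` of a standard member will do,
and such an injection exists by cardinality.  A point member costs ONE term, a standard member costs all its forward traces — which is why point moves
certify instances (memo §7: six admissible instances with no order certificate at all) that order certificates cannot. -/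

/-- **(MS2) from a point-or-standard SKELETON by counting** (hp-7 gen 78).  Given a rank `r` on `F = P ∪ Q`, a set `Pt` of point members with
private terms `E f ⊆ f` (a term contained in no other member of rank `≥ r f`), and nonempty forward traces `g \ f` for the standard members: if the
nonempty terms that are neither a point term nor a forward trace of a standard member are at least as numerous as `D₅ ∪ D₂`, then (MS2) holds. -/
theorem ms2_of_card_le_card_psFree {β : Type*} [LinearOrder β] (P Q D₅ D₂ Pt : Finset (Finset α))
    (r : Finset α → β) (E : Finset α → Finset α)
    (hpt : ∀ f ∈ P ∪ Q, f ∈ Pt → E f ⊆ f ∧ E f ∈ ((P ∪ Q) \\ (P ∪ Q)) ∪ (P \\ D₅) ∪ (Q \\ D₂) ∧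
      ∀ g ∈ P ∪ Q, f ≠ g → r f ≤ r g → ¬ E f ⊆ g)
    (hstd : ∀ f ∈ P ∪ Q, f ∉ Pt → ∀ g ∈ P ∪ Q, f ≠ g → r f ≤ r g → (g \ f).Nonempty)
    (hcount : #(D₅ ∪ D₂) ≤ #((((P ∪ Q) \\ (P ∪ Q)) ∪ (P \\ D₅) ∪ (Q \\ D₂)).filter fun t =>
        t ≠ ∅ ∧ (∀ f ∈ P ∪ Q, f ∈ Pt → t ≠ E f) ∧
          ∀ f ∈ P ∪ Q, f ∉ Pt → ∀ g ∈ P ∪ Q, f ≠ g → r f ≤ r g → t ≠ g \ f)) :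
    #((P ∪ Q) ∪ D₅ ∪ D₂) ≤ #(((P ∪ Q) \\ (P ∪ Q)) ∪ (P \\ D₅) ∪ (Q \\ D₂)) := by
  classical
  set T : Finset (Finset α) := ((P ∪ Q) \\ (P ∪ Q)) ∪ (P \\ D₅) ∪ (Q \\ D₂) with hT
  set R : Finset (Finset α) := T.filter fun t =>
        t ≠ ∅ ∧ (∀ f ∈ P ∪ Q, f ∈ Pt → t ≠ E f) ∧
          ∀ f ∈ P ∪ Q, f ∉ Pt → ∀ g ∈ P ∪ Q, f ≠ g → r f ≤ r g → t ≠ g \ f with hR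
  have hle : (↑(D₅ ∪ D₂) : Set (Finset α)).encard ≤ (↑R : Set (Finset α)).encard := by
    rw [Set.encard_coe_eq_coe_finsetCard, Set.encard_coe_eq_coe_finsetCard]
    exact_mod_cast hcount
  obtain ⟨τ, hτR, hτinj⟩ := Set.Finite.exists_injOn_of_encard_le (finite_toSet (D₅ ∪ D₂)) hle
  have hτ : ∀ d ∈ D₅ ∪ D₂, τ d ∈ R := fun d hd => by
    have := hτR (mem_coe.mpr hd)
    simpa using this
  refine ms2_of_psCert P Q D₅ D₂ Pt r τ E ?_ hτinj ?_ ?_ ?_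
  · intro d hd; exact (mem_filter.mp (hτ d hd)).1
  · intro d hd; exact (mem_filter.mp (hτ d hd)).2.1
  · intro f hf hfp
    obtain ⟨h1, h2, h3⟩ := hpt f hf hfp
    exact ⟨h1, h2, fun d hd => (mem_filter.mp (hτ d hd)).2.2.1 f hf hfp, h3⟩
  · intro f hf hfp g hg hne hr
    exact ⟨hstd f hf hfp g hg hne hr, fun d hd => (mem_filter.mp (hτ d hd)).2.2.2 f hf hfp g hg hne hr⟩

end IntervalGame

end Summit.CriticalPhenomena.PercolationContinuityZ3.Theorems
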